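import Summits.MatrixMultiplication.MatrixMultiplication.Theorems.SoloBlindSunflowerFace

/-!
# THEOREM PC(≤1): a face with at most one AB-killer has a rescued colouring (kernel; face-failure theorem)

Sub-programme (K₃), face analysis of Conjecture H♯ (`SoloBlindLocality`, `SoloBlindSunflowerFace`).  Setting: `h`
zero-sum free on `S` (exponent `3`), a target `σ` with `Σ_T h ≠ σ + σ` on `S`, two representations `Tᵢ ≠ Tⱼ` of
`σ` forming a FACE (no third representation inside `U = Tᵢ ∪ Tⱼ`), core `C = Tᵢ ∩ Tⱼ`, wings `A = Tᵢ \ Tⱼ`,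
`B = Tⱼ \ Tᵢ`.  An AB-KILLER is a further representation disjoint from the core (its trace on the face lies in
`A ∪ B`).

THEOREM PC(≤1) (`soloBlind_face_rescued_of_ABKiller_le_one`): if at most one AB-killer exists, there is a red
set `R ⊆ U` such that "`R` red, `S \ R` blue" leaves no representation of `σ` monochromatic and is good
(`R ∈ soloBlindGoodColourings h S σ`).  No AB-killer: `R = C` with the certificate `-(1_{Tᵢ} + 1_{Tⱼ})`
(`soloBlind_face_rescued_of_no_ABKiller`); one AB-killer `T`: after swapping `i, j` one has `B \ T ≠ ∅`
(both wings inside `T` would make `C ∪ (T \ U)` sum to `σ + σ`), and `R = (A \ T) ∪ C ∪ (B ∩ T)` with the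
certificate `1_{Tᵢ} - 1_{Tⱼ} - 1_T` works (`soloBlind_face_rescued_of_one_ABKiller`).

With THEOREM PC(C≤1) of `SoloBlindSunflowerFace` this completes the kernel FACE-FAILURE THEOREM of the notes
(K3.25): a face none of whose inside colourings is rescued has at least two C-killers AND at least two
AB-killers — the face of the 6-vertex witness `P°` of `SoloBlindLocality` (two of each) is the smallest
possible failure type.
-/

namespace Summit.MatrixMultiplication.MatrixMultiplication.Theorems

open Finset

variable {ι : Type*} [DecidableEq ι] {G : Type*} [AddCommGroup G] [DecidableEq G]

/-- NO AB-KILLER: the core red, everything else blue is a rescued good colouring. -/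
theorem soloBlind_face_rescued_of_no_ABKiller (three : ∀ g : G, g + g + g = 0) {h : ι → G}
    {S : Finset ι} (zsf : ∀ T ⊆ S, T.Nonempty → ∑ i ∈ T, h i ≠ 0) {σ : G}
    (hgood : ∀ T ⊆ S, ∑ i ∈ T, h i ≠ σ + σ) {Ti Tj : Finset ι}
    (hTi : Ti ⊆ S) (hTj : Tj ⊆ S) (si : ∑ i ∈ Ti, h i = σ) (sj : ∑ i ∈ Tj, h i = σ) (hne : Ti ≠ Tj)
    (face : ∀ T ⊆ S, ∑ i ∈ T, h i = σ → T ⊆ Ti ∪ Tj → T = Ti ∨ T = Tj)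
    (hAB : ∀ T ⊆ S, ∑ i ∈ T, h i = σ → T ≠ Ti → T ≠ Tj → ¬ Disjoint T (Ti ∩ Tj)) :
    ∃ R ⊆ Ti ∪ Tj, R ∈ soloBlindGoodColourings h S σ ∧
      ∀ T ⊆ S, ∑ i ∈ T, h i = σ → (T ∩ R).Nonempty ∧ (T \ R).Nonempty := by
  classical
  have hUS : Ti ∪ Tj ⊆ S := union_subset hTi hTj
  have hCU : Ti ∩ Tj ⊆ Ti ∪ Tj := inter_subset_left.trans subset_union_left
  have hCne : (Ti ∩ Tj).Nonempty := by
    by_contra h'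
    rw [not_nonempty_iff_eq_empty, ← disjoint_iff_inter_eq_empty] at h'
    exact soloBlind_rep_not_disjoint hgood hTi hTj si sj h'
  have hAne : (Ti \ Tj).Nonempty := soloBlind_rep_sdiff_nonempty zsf hTj si sj hne
  have hBne : (Tj \ Ti).Nonempty := soloBlind_rep_sdiff_nonempty zsf hTi sj si hne.symm
  have s5 : ∑ i ∈ Ti ∩ Tj, h i + ∑ i ∈ Ti \ Tj, h i = σ := by rw [sum_inter_add_sum_sdiff, si]
  have s6 : ∑ i ∈ Ti ∩ Tj, h i + ∑ i ∈ Tj \ Ti, h i = σ := by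
    rw [inter_comm, sum_inter_add_sum_sdiff, sj]
  have ha : ∑ i ∈ Ti \ Tj, h i = σ - ∑ i ∈ Ti ∩ Tj, h i := by rw [← s5]; abel
  have hb : ∑ i ∈ Tj \ Ti, h i = σ - ∑ i ∈ Ti ∩ Tj, h i := by rw [← s6]; abel
  have dAB : Disjoint (Ti \ Tj) (Tj \ Ti) := by
    rw [disjoint_left]
    intro x hx hx'
    exact (mem_sdiff.mp hx).2 (mem_sdiff.mp hx').1
  -- certificate `-(1_{Tᵢ} + 1_{Tⱼ})`: red part `C`, blue part `A ∪ B`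
  have hw : ∑ i ∈ Ti ∩ Tj, h i - ∑ i ∈ (Ti \ Tj) ∪ (Tj \ Ti), h i = σ := by
    have key : ∑ i ∈ Ti ∩ Tj, h i - ∑ i ∈ (Ti \ Tj) ∪ (Tj \ Ti), h i - σ
        = (∑ i ∈ Ti ∩ Tj, h i + ∑ i ∈ Ti ∩ Tj, h i + ∑ i ∈ Ti ∩ Tj, h i) - (σ + σ + σ) := by
      rw [sum_union dAB, ha, hb]; abel
    rw [three, three, sub_self, sub_eq_zero] at key
    exact key
  have hBl : (Ti \ Tj) ∪ (Tj \ Ti) ⊆ S \ (Ti ∩ Tj) := by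
    intro x hx
    rw [mem_sdiff]
    rcases mem_union.mp hx with hx | hx
    · exact ⟨hTi (mem_sdiff.mp hx).1, fun hxC => (mem_sdiff.mp hx).2 (mem_inter.mp hxC).2⟩
    · exact ⟨hTj (mem_sdiff.mp hx).1, fun hxC => (mem_sdiff.mp hx).2 (mem_inter.mp hxC).1⟩
  refine ⟨Ti ∩ Tj, hCU, ?_, ?_⟩
  · rw [soloBlind_mem_goodColourings]
    refine ⟨hCU.trans hUS, Or.inr ⟨_, ?_, soloBlind_subsum_of_cert h disjoint_sdiff hBl hw⟩⟩
    exact union_subset (hCU.trans hUS) (sdiff_subset.trans sdiff_subset)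
  · intro T hT sT
    by_cases h1 : T = Ti
    · rw [h1]
      obtain ⟨x, hx⟩ := hAne
      obtain ⟨y, hy⟩ := hCne
      exact ⟨⟨y, mem_inter.mpr ⟨(mem_inter.mp hy).1, hy⟩⟩,
        ⟨x, mem_sdiff.mpr ⟨(mem_sdiff.mp hx).1, fun hxC => (mem_sdiff.mp hx).2 (mem_inter.mp hxC).2⟩⟩⟩
    by_cases h2 : T = Tj
    · rw [h2]
      obtain ⟨x, hx⟩ := hBne
      obtain ⟨y, hy⟩ := hCne
      exact ⟨⟨y, mem_inter.mpr ⟨(mem_inter.mp hy).2, hy⟩⟩,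
        ⟨x, mem_sdiff.mpr ⟨(mem_sdiff.mp hx).1, fun hxC => (mem_sdiff.mp hx).2 (mem_inter.mp hxC).1⟩⟩⟩
    have hout : (T \ (Ti ∪ Tj)).Nonempty := by
      by_contra hempty
      rw [not_nonempty_iff_eq_empty, sdiff_eq_empty_iff_subset] at hempty
      rcases face T hT sT hempty with h' | h'
      · exact h1 h'
      · exact h2 h'
    obtain ⟨w, hw'⟩ := hout
    obtain ⟨x, hxT, hxC⟩ := not_disjoint_iff.mp (hAB T hT sT h1 h2)
    exact ⟨⟨x, mem_inter.mpr ⟨hxT, hxC⟩⟩,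
      ⟨w, mem_sdiff.mpr ⟨(mem_sdiff.mp hw').1, fun hwC => (mem_sdiff.mp hw').2 (hCU hwC)⟩⟩⟩

/-- ONE AB-KILLER `Tm`, normalised so that `B \ Tm ≠ ∅`: the colouring `(A \ Tm) ∪ C ∪ (B ∩ Tm)` red is
rescued and good (certificate `1_{Tᵢ} - 1_{Tⱼ} - 1_{Tm}`). -/
theorem soloBlind_face_rescued_of_one_ABKiller (three : ∀ g : G, g + g + g = 0) {h : ι → G}
    {S : Finset ι} {σ : G} (hgood : ∀ T ⊆ S, ∑ i ∈ T, h i ≠ σ + σ) {Ti Tj Tm : Finset ι}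
    (hTi : Ti ⊆ S) (hTj : Tj ⊆ S) (hTm : Tm ⊆ S) (si : ∑ i ∈ Ti, h i = σ) (sj : ∑ i ∈ Tj, h i = σ)
    (sm : ∑ i ∈ Tm, h i = σ) (hdm : Disjoint Tm (Ti ∩ Tj))
    (face : ∀ T ⊆ S, ∑ i ∈ T, h i = σ → T ⊆ Ti ∪ Tj → T = Ti ∨ T = Tj)
    (uniq : ∀ T ⊆ S, ∑ i ∈ T, h i = σ → T ≠ Ti → T ≠ Tj → Disjoint T (Ti ∩ Tj) → T = Tm)
    (hB : ((Tj \ Ti) \ Tm).Nonempty) :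
    ∃ R ⊆ Ti ∪ Tj, R ∈ soloBlindGoodColourings h S σ ∧
      ∀ T ⊆ S, ∑ i ∈ T, h i = σ → (T ∩ R).Nonempty ∧ (T \ R).Nonempty := by
  classical
  have hUS : Ti ∪ Tj ⊆ S := union_subset hTi hTj
  have hCU : Ti ∩ Tj ⊆ Ti ∪ Tj := inter_subset_left.trans subset_union_left
  have hCne : (Ti ∩ Tj).Nonempty := by
    by_contra h'
    rw [not_nonempty_iff_eq_empty, ← disjoint_iff_inter_eq_empty] at h'
    exact soloBlind_rep_not_disjoint hgood hTi hTj si sj h'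
  have out : ∀ T ⊆ S, ∑ i ∈ T, h i = σ → T ≠ Ti → T ≠ Tj → (T \ (Ti ∪ Tj)).Nonempty := by
    intro T hT sT h1 h2
    by_contra hempty
    rw [not_nonempty_iff_eq_empty, sdiff_eq_empty_iff_subset] at hempty
    rcases face T hT sT hempty with h' | h'
    · exact h1 h'
    · exact h2 h'
  -- `Tm` meets both wings
  have noC : ∀ x ∈ Tm, x ∈ Ti → x ∈ Tj → False :=
    fun x hxm hxi hxj => disjoint_left.mp hdm hxm (mem_inter.mpr ⟨hxi, hxj⟩)
  have hα : (Tm ∩ (Ti \ Tj)).Nonempty := by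
    obtain ⟨x, hxm, hxi⟩ := not_disjoint_iff.mp (soloBlind_rep_not_disjoint hgood hTm hTi sm si)
    exact ⟨x, mem_inter.mpr ⟨hxm, mem_sdiff.mpr ⟨hxi, fun hxj => noC x hxm hxi hxj⟩⟩⟩
  have hβ : (Tm ∩ (Tj \ Ti)).Nonempty := by
    obtain ⟨x, hxm, hxj⟩ := not_disjoint_iff.mp (soloBlind_rep_not_disjoint hgood hTm hTj sm sj)
    exact ⟨x, mem_inter.mpr ⟨hxm, mem_sdiff.mpr ⟨hxj, fun hxi => noC x hxm hxi hxj⟩⟩⟩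
  -- sums of the pieces
  have s5 : ∑ i ∈ Ti ∩ Tj, h i + ∑ i ∈ Ti \ Tj, h i = σ := by rw [sum_inter_add_sum_sdiff, si]
  have s6 : ∑ i ∈ Ti ∩ Tj, h i + ∑ i ∈ Tj \ Ti, h i = σ := by
    rw [inter_comm, sum_inter_add_sum_sdiff, sj]
  have s2 : ∑ i ∈ (Ti \ Tj) ∩ Tm, h i + ∑ i ∈ (Ti \ Tj) \ Tm, h i = ∑ i ∈ Ti \ Tj, h i :=
    sum_inter_add_sum_sdiff _ _ _
  have s1 : ∑ i ∈ (Tj \ Ti) ∩ Tm, h i + ∑ i ∈ (Tj \ Ti) \ Tm, h i = ∑ i ∈ Tj \ Ti, h i :=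
    sum_inter_add_sum_sdiff _ _ _
  have s3 : ∑ i ∈ Tm ∩ (Ti ∪ Tj), h i + ∑ i ∈ Tm \ (Ti ∪ Tj), h i = σ := by
    rw [sum_inter_add_sum_sdiff, sm]
  have E : Tm ∩ (Ti ∪ Tj) = ((Ti \ Tj) ∩ Tm) ∪ ((Tj \ Ti) ∩ Tm) := by
    ext x
    simp only [mem_inter, mem_union, mem_sdiff]
    constructor
    · rintro ⟨hxm, hxi | hxj⟩
      · by_cases hxj : x ∈ Tj
        · exact (noC x hxm hxi hxj).elim
        · exact Or.inl ⟨⟨hxi, hxj⟩, hxm⟩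
      · by_cases hxi : x ∈ Ti
        · exact (noC x hxm hxi hxj).elim
        · exact Or.inr ⟨⟨hxj, hxi⟩, hxm⟩
    · rintro (⟨⟨hxi, -⟩, hxm⟩ | ⟨⟨hxj, -⟩, hxm⟩)
      · exact ⟨hxm, Or.inl hxi⟩
      · exact ⟨hxm, Or.inr hxj⟩
  have D : Disjoint ((Ti \ Tj) ∩ Tm) ((Tj \ Ti) ∩ Tm) := by
    rw [disjoint_left]
    intro x hx hx'
    exact (mem_sdiff.mp (mem_inter.mp hx).1).2 (mem_sdiff.mp (mem_inter.mp hx').1).1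
  have s4 : ∑ i ∈ Tm ∩ (Ti ∪ Tj), h i
      = ∑ i ∈ (Ti \ Tj) ∩ Tm, h i + ∑ i ∈ (Tj \ Ti) ∩ Tm, h i := by rw [E, sum_union D]
  have ha : ∑ i ∈ Ti \ Tj, h i = σ - ∑ i ∈ Ti ∩ Tj, h i := by rw [← s5]; abel
  have hb : ∑ i ∈ Tj \ Ti, h i = σ - ∑ i ∈ Ti ∩ Tj, h i := by rw [← s6]; abel
  have hp' : ∑ i ∈ (Ti \ Tj) \ Tm, h i = ∑ i ∈ Ti \ Tj, h i - ∑ i ∈ (Ti \ Tj) ∩ Tm, h i := by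
    rw [← s2]; abel
  have hq' : ∑ i ∈ (Tj \ Ti) \ Tm, h i = ∑ i ∈ Tj \ Ti, h i - ∑ i ∈ (Tj \ Ti) ∩ Tm, h i := by
    rw [← s1]; abel
  have ho : ∑ i ∈ Tm \ (Ti ∪ Tj), h i
      = σ - (∑ i ∈ (Ti \ Tj) ∩ Tm, h i + ∑ i ∈ (Tj \ Ti) ∩ Tm, h i) := by
    rw [← s3, s4]; abel
  -- the certificate: blue part `B' = (B \ Tm) ∪ (Tm \ U)`, red part `A' = (A \ Tm) ∪ (B ∩ Tm)`
  have dB' : Disjoint ((Tj \ Ti) \ Tm) (Tm \ (Ti ∪ Tj)) := by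
    rw [disjoint_left]
    intro x hx hx'
    exact (mem_sdiff.mp hx').2 (mem_union_right _ (mem_sdiff.mp (mem_sdiff.mp hx).1).1)
  have dA' : Disjoint ((Ti \ Tj) \ Tm) ((Tj \ Ti) ∩ Tm) := by
    rw [disjoint_left]
    intro x hx hx'
    exact (mem_sdiff.mp hx).2 (mem_inter.mp hx').2
  have hw : ∑ i ∈ ((Tj \ Ti) \ Tm) ∪ (Tm \ (Ti ∪ Tj)), h i
      - ∑ i ∈ ((Ti \ Tj) \ Tm) ∪ ((Tj \ Ti) ∩ Tm), h i = σ := by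
    have key : ∑ i ∈ ((Tj \ Ti) \ Tm) ∪ (Tm \ (Ti ∪ Tj)), h i
        - ∑ i ∈ ((Ti \ Tj) \ Tm) ∪ ((Tj \ Ti) ∩ Tm), h i - σ
        = -(∑ i ∈ (Tj \ Ti) ∩ Tm, h i + ∑ i ∈ (Tj \ Ti) ∩ Tm, h i + ∑ i ∈ (Tj \ Ti) ∩ Tm, h i) := by
      rw [sum_union dB', sum_union dA', hq', ho, hp', ha, hb]; abel
    rw [three, neg_zero, sub_eq_zero] at key
    exact key
  -- the red set
  have hRU : ((Ti \ Tj) \ Tm) ∪ (Ti ∩ Tj) ∪ ((Tj \ Ti) ∩ Tm) ⊆ Ti ∪ Tj :=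
    union_subset (union_subset (sdiff_subset.trans (sdiff_subset.trans subset_union_left)) hCU)
      (inter_subset_left.trans (sdiff_subset.trans subset_union_right))
  have hRS : ((Ti \ Tj) \ Tm) ∪ (Ti ∩ Tj) ∪ ((Tj \ Ti) ∩ Tm) ⊆ S := hRU.trans hUS
  have hA'R : ((Ti \ Tj) \ Tm) ∪ ((Tj \ Ti) ∩ Tm) ⊆ ((Ti \ Tj) \ Tm) ∪ (Ti ∩ Tj) ∪ ((Tj \ Ti) ∩ Tm) :=
    union_subset (subset_union_left.trans subset_union_left) subset_union_right
  have hB'R : Disjoint (((Tj \ Ti) \ Tm) ∪ (Tm \ (Ti ∪ Tj)))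
      (((Ti \ Tj) \ Tm) ∪ (Ti ∩ Tj) ∪ ((Tj \ Ti) ∩ Tm)) := by
    rw [disjoint_left]
    intro x hx hxR
    rcases mem_union.mp hx with hx | hx
    · have hxj : x ∈ Tj := (mem_sdiff.mp (mem_sdiff.mp hx).1).1
      have hxi : x ∉ Ti := (mem_sdiff.mp (mem_sdiff.mp hx).1).2
      rcases mem_union.mp hxR with hxR | hxR
      · rcases mem_union.mp hxR with hxR | hxR
        · exact hxi (mem_sdiff.mp (mem_sdiff.mp hxR).1).1
        · exact hxi (mem_inter.mp hxR).1
      · exact (mem_sdiff.mp hx).2 (mem_inter.mp hxR).2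
    · exact (mem_sdiff.mp hx).2 (hRU hxR)
  refine ⟨((Ti \ Tj) \ Tm) ∪ (Ti ∩ Tj) ∪ ((Tj \ Ti) ∩ Tm), hRU, ?_, ?_⟩
  · rw [soloBlind_mem_goodColourings]
    refine ⟨hRS, Or.inl ⟨_, ?_, soloBlind_subsum_of_cert h hB'R hA'R hw⟩⟩
    exact union_subset (union_subset (sdiff_subset.trans (sdiff_subset.trans hTj))
      (sdiff_subset.trans hTm)) (sdiff_subset.trans hRS)
  · intro T hT sT
    obtain ⟨y, hy⟩ := hCne
    have hyR : y ∈ ((Ti \ Tj) \ Tm) ∪ (Ti ∩ Tj) ∪ ((Tj \ Ti) ∩ Tm) :=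
      mem_union_left _ (mem_union_right _ hy)
    by_cases h1 : T = Ti
    · rw [h1]
      obtain ⟨x, hx⟩ := hα
      have hxm : x ∈ Tm := (mem_inter.mp hx).1
      have hxi : x ∈ Ti := (mem_sdiff.mp (mem_inter.mp hx).2).1
      have hxj : x ∉ Tj := (mem_sdiff.mp (mem_inter.mp hx).2).2
      refine ⟨⟨y, mem_inter.mpr ⟨(mem_inter.mp hy).1, hyR⟩⟩, ⟨x, mem_sdiff.mpr ⟨hxi, fun hxR => ?_⟩⟩⟩
      rcases mem_union.mp hxR with hxR | hxR
      · rcases mem_union.mp hxR with hxR | hxR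
        · exact (mem_sdiff.mp hxR).2 hxm
        · exact hxj (mem_inter.mp hxR).2
      · exact hxj (mem_sdiff.mp (mem_inter.mp hxR).1).1
    by_cases h2 : T = Tj
    · rw [h2]
      obtain ⟨z, hz⟩ := hB
      have hzj : z ∈ Tj := (mem_sdiff.mp (mem_sdiff.mp hz).1).1
      have hzi : z ∉ Ti := (mem_sdiff.mp (mem_sdiff.mp hz).1).2
      have hzm : z ∉ Tm := (mem_sdiff.mp hz).2
      refine ⟨⟨y, mem_inter.mpr ⟨(mem_inter.mp hy).2, hyR⟩⟩, ⟨z, mem_sdiff.mpr ⟨hzj, fun hzR => ?_⟩⟩⟩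
      rcases mem_union.mp hzR with hzR | hzR
      · rcases mem_union.mp hzR with hzR | hzR
        · exact hzi (mem_sdiff.mp (mem_sdiff.mp hzR).1).1
        · exact hzi (mem_inter.mp hzR).1
      · exact hzm (mem_inter.mp hzR).2
    obtain ⟨w, hw'⟩ := out T hT sT h1 h2
    refine ⟨?_, ⟨w, mem_sdiff.mpr ⟨(mem_sdiff.mp hw').1, fun hwR => (mem_sdiff.mp hw').2 (hRU hwR)⟩⟩⟩
    by_cases h3 : T = Tm
    · rw [h3]
      obtain ⟨x, hx⟩ := hβ
      exact ⟨x, mem_inter.mpr ⟨(mem_inter.mp hx).1,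
        mem_union_right _ (mem_inter.mpr ⟨(mem_inter.mp hx).2, (mem_inter.mp hx).1⟩)⟩⟩
    -- any other representation meets the (red) core, or it would be a second AB-killer
    have hnd : ¬ Disjoint T (Ti ∩ Tj) := fun hd => h3 (uniq T hT sT h1 h2 hd)
    obtain ⟨x, hxT, hxC⟩ := not_disjoint_iff.mp hnd
    exact ⟨x, mem_inter.mpr ⟨hxT, mem_union_left _ (mem_union_right _ hxC)⟩⟩

/-- THEOREM PC(≤1): a face with at most one AB-killer has a rescued good colouring. -/
theorem soloBlind_face_rescued_of_ABKiller_le_one (three : ∀ g : G, g + g + g = 0) {h : ι → G}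
    {S : Finset ι} (zsf : ∀ T ⊆ S, T.Nonempty → ∑ i ∈ T, h i ≠ 0) {σ : G}
    (hgood : ∀ T ⊆ S, ∑ i ∈ T, h i ≠ σ + σ) {Ti Tj : Finset ι}
    (hTi : Ti ⊆ S) (hTj : Tj ⊆ S) (si : ∑ i ∈ Ti, h i = σ) (sj : ∑ i ∈ Tj, h i = σ) (hne : Ti ≠ Tj)
    (face : ∀ T ⊆ S, ∑ i ∈ T, h i = σ → T ⊆ Ti ∪ Tj → T = Ti ∨ T = Tj)
    (hAB : ∀ T ⊆ S, ∀ T' ⊆ S, ∑ i ∈ T, h i = σ → ∑ i ∈ T', h i = σ → T ≠ Ti → T ≠ Tj → T' ≠ Ti →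
      T' ≠ Tj → Disjoint T (Ti ∩ Tj) → Disjoint T' (Ti ∩ Tj) → T = T') :
    ∃ R ⊆ Ti ∪ Tj, R ∈ soloBlindGoodColourings h S σ ∧
      ∀ T ⊆ S, ∑ i ∈ T, h i = σ → (T ∩ R).Nonempty ∧ (T \ R).Nonempty := by
  classical
  by_cases hex : ∃ T ⊆ S, ∑ i ∈ T, h i = σ ∧ T ≠ Ti ∧ T ≠ Tj ∧ Disjoint T (Ti ∩ Tj)
  · obtain ⟨Tm, hTm, sm, hm1, hm2, hdm⟩ := hex
    have uniq : ∀ T ⊆ S, ∑ i ∈ T, h i = σ → T ≠ Ti → T ≠ Tj → Disjoint T (Ti ∩ Tj) → T = Tm :=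
      fun T hT sT h1 h2 hd => hAB T hT Tm hTm sT sm h1 h2 hm1 hm2 hd hdm
    -- not both wings inside `Tm`
    have noC : ∀ x ∈ Tm, x ∈ Ti → x ∈ Tj → False :=
      fun x hxm hxi hxj => disjoint_left.mp hdm hxm (mem_inter.mpr ⟨hxi, hxj⟩)
    have wings : ((Tj \ Ti) \ Tm).Nonempty ∨ ((Ti \ Tj) \ Tm).Nonempty := by
      by_contra hno
      push Not at hno
      obtain ⟨hB0, hA0⟩ := hno
      rw [sdiff_eq_empty_iff_subset] at hA0 hB0
      -- then `C ∪ (Tm \ U)` sums to `σ + σ`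
      have s5 : ∑ i ∈ Ti ∩ Tj, h i + ∑ i ∈ Ti \ Tj, h i = σ := by rw [sum_inter_add_sum_sdiff, si]
      have s6 : ∑ i ∈ Ti ∩ Tj, h i + ∑ i ∈ Tj \ Ti, h i = σ := by
        rw [inter_comm, sum_inter_add_sum_sdiff, sj]
      have s3 : ∑ i ∈ Tm ∩ (Ti ∪ Tj), h i + ∑ i ∈ Tm \ (Ti ∪ Tj), h i = σ := by
        rw [sum_inter_add_sum_sdiff, sm]
      have E : Tm ∩ (Ti ∪ Tj) = (Ti \ Tj) ∪ (Tj \ Ti) := by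
        ext x
        simp only [mem_inter, mem_union, mem_sdiff]
        constructor
        · rintro ⟨hxm, hxi | hxj⟩
          · by_cases hxj : x ∈ Tj
            · exact (noC x hxm hxi hxj).elim
            · exact Or.inl ⟨hxi, hxj⟩
          · by_cases hxi : x ∈ Ti
            · exact (noC x hxm hxi hxj).elim
            · exact Or.inr ⟨hxj, hxi⟩
        · rintro (⟨hxi, hxj⟩ | ⟨hxj, hxi⟩)
          · exact ⟨hA0 (mem_sdiff.mpr ⟨hxi, hxj⟩), Or.inl hxi⟩
          · exact ⟨hB0 (mem_sdiff.mpr ⟨hxj, hxi⟩), Or.inr hxj⟩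
      have dAB : Disjoint (Ti \ Tj) (Tj \ Ti) := by
        rw [disjoint_left]
        intro x hx hx'
        exact (mem_sdiff.mp hx).2 (mem_sdiff.mp hx').1
      have dCO : Disjoint (Ti ∩ Tj) (Tm \ (Ti ∪ Tj)) := by
        rw [disjoint_left]
        intro x hx hx'
        exact (mem_sdiff.mp hx').2 (mem_union_left _ (mem_inter.mp hx).1)
      have key : ∑ i ∈ (Ti ∩ Tj) ∪ (Tm \ (Ti ∪ Tj)), h i - (σ + σ)
          = (∑ i ∈ Ti ∩ Tj, h i + ∑ i ∈ Ti ∩ Tj, h i + ∑ i ∈ Ti ∩ Tj, h i) - (σ + σ + σ) := by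
        have ho : ∑ i ∈ Tm \ (Ti ∪ Tj), h i = σ - (∑ i ∈ Ti \ Tj, h i + ∑ i ∈ Tj \ Ti, h i) := by
          rw [← s3, E, sum_union dAB]; abel
        have ha : ∑ i ∈ Ti \ Tj, h i = σ - ∑ i ∈ Ti ∩ Tj, h i := by rw [← s5]; abel
        have hb : ∑ i ∈ Tj \ Ti, h i = σ - ∑ i ∈ Ti ∩ Tj, h i := by rw [← s6]; abel
        rw [sum_union dCO, ho, ha, hb]; abel
      rw [three, three, sub_self, sub_eq_zero] at key
      exact hgood _ (union_subset (inter_subset_left.trans hTi) (sdiff_subset.trans hTm)) key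
    rcases wings with hB | hA
    · exact soloBlind_face_rescued_of_one_ABKiller three hgood hTi hTj hTm si sj sm hdm face uniq hB
    · -- swap the roles of `Tᵢ` and `Tⱼ`
      have hdm' : Disjoint Tm (Tj ∩ Ti) := by rwa [inter_comm]
      have face' : ∀ T ⊆ S, ∑ i ∈ T, h i = σ → T ⊆ Tj ∪ Ti → T = Tj ∨ T = Ti :=
        fun T hT sT hsub => (face T hT sT (by rwa [union_comm] at hsub)).symm
      have uniq' : ∀ T ⊆ S, ∑ i ∈ T, h i = σ → T ≠ Tj → T ≠ Ti → Disjoint T (Tj ∩ Ti) → T = Tm :=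
        fun T hT sT h2 h1 hd => uniq T hT sT h1 h2 (by rwa [inter_comm] at hd)
      obtain ⟨R, hR, hgoodR, hmono⟩ := soloBlind_face_rescued_of_one_ABKiller three hgood hTj hTi
        hTm sj si sm hdm' face' uniq' hA
      exact ⟨R, by rwa [union_comm] at hR, hgoodR, hmono⟩
  · push Not at hex
    exact soloBlind_face_rescued_of_no_ABKiller three zsf hgood hTi hTj si sj hne face
      (fun T hT sT h1 h2 hd => (hex T hT sT h1 h2) hd)

end Summit.MatrixMultiplication.MatrixMultiplication.Theorems
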